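import Literature.MathematicalPhysics.QuantumFieldTheory.Federbush1986.PhaseCellIVLatticeHierarchy

/-!
# Federbush, *A phase cell approach to Yang–Mills theory. IV. The choice of variables* (CMP **114** (1988) 317–343) —
# §2 «The Isolated Pure Mode» (2.1)–(2.4), §3 «The Isolated A-Mode», §8 «The Geometric Content of the Chunks» ((8.1), hunks,
# chunks, Well-Separation), §9 «The Isolated Chunk Field» (9.1)–(9.6) and the Global Gauge Requirement, §10 «Field
# Interpolation» (10.1)–(10.3), (10.5)–(10.9) — TYPED (definitions with bodies / explicit predicates; the located elementary
# sentences PROVED)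

statement-level skeleton of published theorems with citation tags; proofs where landed; nothing here is a claim about the Yang–Mills mass gap

Cell `lit-balaban`, reader/typer block **r19** (F4 fold owner), inventory rows `F4.Def§2–§3` and `F4.Def§8–§10` of
`run/shared/lean/pub/lit-balaban/lit-balaban-r19/ROWS-F4.md`; companion of `PhaseCellIVLatticeHierarchy` (§1: lattices, blocks,
channels, `EdgeClasses`, `Mode`), `PhaseCellIVExcitationCoupling` (§§4–7, (10.4)) and `PhaseCellIVGaugeInterpolation` (§11).  The
continuum fields of the modes («[2, 3] present a continuum `A` field of this mode», p. 326) are F-I/F-II (r17's block: `Mode*`,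
`AbelianModeEstimates`, …) and are NOT re-typed here.

**Source.** P. Federbush, Commun. Math. Phys. **114** (1988) 317–343 [bib `Federbush1988PhaseCellIV`; doi:10.1007/bf01225039;
lit store `paper:doi-10-1007-bf01225039`; journal page = PDF page + 316], pp. 325–327 [PDF 9–11], 332–335 [PDF 16–19] READ AS
IMAGES (renders `lit-balaban-r19/renders/f4/f4-p009.png` … `f4-p011.png`, `f4-p016.png` … `f4-p019.png`).  Verbatim:

* §2 p. 325–326: «We first consider a channel mode of level `r`.  We call the mode `m`, and the associated edge in `ℰ_CM` by
  `e(m)`.  `e(m)` is the *home edge* of `m`. … the channel containing `e(m)`, let `e_a` be the averaging edge.  `e_a` is the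
  *home averaging edge* of `m`, and we write it as `ē(m)`, `v` will be the *pinning (vertex)* of `m`. …  We write `g(m, e)` for
  the group element assigned to the edge `e` by the isolated mode `m`.  We also write `g(m, e) = e^{A(m,e)}`, (2.1) `A(m, e)`, an
  element of the Lie algebra of `G`, will be small.  If `e` is in `ℰ^{r′}` with `r′ < r`, then `A(m, e) = 0`.  If `e` is in
  `ℰ^r`, but `e ≠ e(m)`, `e ≠ ē(m)`, then `A(m, e) = 0`.  On the home and home averaging edges we have `g(m, e(m)) =
  g⁻¹(m, ē(m))` (2.2) or equivalently `A(m, e(m)) = −A(m, ē(m))` (2.3) …  We now turn to a block mode `m` at level `r`. … `e(m)`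
  in `ℰ_BM` is the home edge of `m` … If `e′` and `e″` … are both in `ℰ_A`, and parallel to `e(m)` as indicated, then `e′` and `e″`
  are the two home averaging edges of `m`, (`ē₁` and `ē₂`). …  For `e` in `ℰ^{r′}`, with `r′ < r`, `A(m, e) = 0`.  If `e` is in
  `ℰ^r`, but `e ≠ e(m)`, `e ≠ ē₁(m)`, `e ≠ ē₂(m)`, then `A(m, e) = 0`.  On the home and home averaging edges we have `A(m, ē₁(m)) =
  −k₁A(m, e(m))`, `A(m, ē₂(m)) = −k₂A(m, e(m))`, (2.4) where `k₁` and `k₂` are numerical factors depending only on the position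
  of `e(m)` in the block. …  *Note.* For our modes in this section all the `A`'s are proportional to the same Lie algebra
  element».  §3 p. 326–327: «Let `m` be an `A`-mode of level `r`, so its home edge `e(m)` is in `ℰ_A^r`.  Its amplitude is
  `A(m, e(m))` … consistent with assignments on level `r` of `A(m, e(m))` to `e(m)` and of zero to other edges in `ℰ^r`. … for
  all edges `e` in `ℰ^{r′}`, `r′ < r`, we set `A(m, e) = 0`.»
* §8 p. 332: «Let `p` be an `L`-plaquette in some `p^r`.  We let `𝓜(p)` be the set of edges, in `ℰ^s`, `r − N_cr ≤ s ≤ r + 1`, …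
  determined as the minimal set satisfying: 1) At each level … it is a union of blocks and channels.  2) At each such level it
  contains all edges within distance `(N_cr + C_1c)N^{−s}` of `p`. …  We say `𝓜(p₁)` and `𝓜(p₂)` "overlap" if they share an
  edge. …  The *hunks* are the connected components of this set. …  Each chunk will be a union of hunks, the chunks will be
  disjoint, and their union will be the union of hunks. …  This partition is selected as a finest partition (not necessarily
  unique?) for which the following property holds.  *Well-Separation of Chunks.* Let `E` be a chunk of diameter `d(E)`.  We
  let `ℰ_u(E)`, the *umbrella edges* of `E`, be the union of edges of length `≤ C_2c d(E)`, and at distance `≤ C_2c d(E)` from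
  `E`. …  Then if `E′` is any chunk with `d(E′) ≥ d(E)`, the edges of `E′` do not intersect the edges in `ℰ_u(E)`. …  The level
  `r(E)` of a chunk `E` is the level of its highest level edges.  The effective level `r_e(E)` of a chunk is the largest `r′`
  such that `N^{−r′} ≥ d(E)` (8.1) …  [We do not let `r_e(E)` be negative, if (8.1) selects a negative number we set `r_e = 0`.]
  `v(E)`, the pinning vertex, is in `𝒱^{r_e}`, and chosen at distance `< N^{−r_e}` from `E`.»
* §9 p. 333: «`g(e) = g(e, r(e))` if `e ∈ ℰ_I`. (9.1)  We introduce `g^δ(·, ·)` such that `g(e, r) = g^δ(e, r) g(e, r − 1)`. (9.2)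
  *Global Gauge Requirement.* If the internal variables of a chunk are modified by sending `g → hgh⁻¹`, for some fixed `h`,
  then the isolated field assignment to any edge `e` likewise is changed `g(e) → hg(e)h⁻¹`. …  `g(e) = Id` if `r(e) < r(E)`.
  (9.3) …  `g(e) = Id` if `e ∈ ℰ_I^{r(E)}`, (9.4)  `g(e) = Id` if `r(e) = r(E)`, `e ∉ E`, `e ∉ ℰ_A`. (9.5) …  `g(e, r) = Id`, for
  `r ≤ r(E)`. (9.6)»
* §10 p. 334–335: «We will later want a `C^∞` partition of unity associated to these vertices, `{φ′_v(x)}`, such that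
  `φ′_v(x) = 0` for `d(x, v) > 4N^{−r}`. (10.1)  We require `Σ_{v∈𝒱_c^r} φ′_v(x) = 1` outside `E ∩ ℒ^r` …  `g(e′) = Av_v g^v(e′)`,
  (10.2) defined by minimizing `Σ_v φ′_v(ê′) d²(g(e′), g^v(e′))`, (10.3) …  `h(e) = e^{Σ_α A^α(e) L_α}`, (10.5) …
  `d(e, v) < (C_1c/2)·N^{−r}`. (10.6) …  `A(e) = A^α(e)` if `d(e, v) < (C_1c/2)·N^{−r}`; `= A₀^α(e)` if `d(e, v) ≥ (C_1c/2)·N^{−r}`.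
  (10.7) …  `h̃_v(e′) = e^{Σ_α A^α(e′) L_α}`. (10.8) …  `g^v(e′) = ψ⁻¹(v_a) h̃_v(e′) ψ(v_b)`. (10.9)»

**What this file does.**
* §1 (§2–§3): an `AveragingChoice` («In each channel we select a distinguished channel edge») with EXACTLY ONE averaging edge
  per channel (PROVED: channels are disjoint); the home averaging edge(s) of a channel / block mode; the level-`r`
  Lie-algebra assignments (2.1)–(2.4) and of an `A`-mode (§3) as functions `ℰ^r → 𝔤` with bodies; (2.3), (2.4), (2.2) (from
  `exp(−a) = exp(a)⁻¹`) and the Note «all the `A`'s are proportional to the same Lie algebra element» PROVED.  The factors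
  `k₁, k₂` are parameters (print: «numerical factors depending only on the position of `e(m)` in the block»).
* §2 (§8): overlap / hunks (connected components of the overlap relation, an equivalence relation), chunk partitions and the
  Well-Separation property as explicit predicates over an abstract edge geometry (lengths, distances, diameters in `R⁴` are
  parameters, as are `N_cr, C_1c, C_2c`); **(8.1)** `effLevel N δ` with `N^{−r_e} ≥ δ > N^{−(r_e+1)}` PROVED (for `0 < δ ≤ 1`,
  `N ≥ 2`; `r_e = 0` when `δ > 1`).
* §3 (§9): (9.2) `gDelta`, the identity rules (9.1), (9.3)–(9.6) as one predicate `ChunkFieldRules`, the Global Gauge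
  Requirement `GlobalGaugeReq` (conjugation-equivariance of the assignment in the internal variables).
* §4 (§10): (10.1) `IsLocalPOU`, (10.2)–(10.3) `IsFieldAverage` (an `IsMinOn` predicate), (10.7) `cutoffField`, (10.9)
  `regauge` — definitions.  ((10.4), the tree gauge, is in `PhaseCellIVExcitationCoupling`.)
No `sorry`; no unproved `Prop`-facts (every `Prop` here is a definition of a printed REQUIREMENT, not an asserted result).
-/

namespace Literature.MathematicalPhysics.QuantumFieldTheory.Federbush1986

noncomputable section

open Set

namespace PhaseCellIVLattice

variable {d : ℕ}

/-! ## 1. §2–§3: averaging choices, home averaging edges, the level-`r` assignments of pure modes and `A`-modes -/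

/-- Equality of lattice edges is decidable (needed for the case definitions (2.3)–(2.4)).
[cite: Federbush1988PhaseCellIV, §1 p. 322–323] -/
instance : DecidableEq (LEdge d) := fun a b =>
  if h : a.src = b.src ∧ a.dir = b.dir then isTrue (by cases a; cases b; cases h; simp_all)
  else isFalse (by rintro rfl; exact h ⟨rfl, rfl⟩)

/-- Distinct channels are disjoint: an edge determines its channel (direction and block of its tail).
[cite: Federbush1988PhaseCellIV, §1 p. 323] -/
theorem channel_disjoint {M : ℕ} {m m' : Fin d → ℤ} {μ μ' : Fin d} {e : LEdge d} (h : e ∈ channel M m μ)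
    (h' : e ∈ channel M m' μ') : m = m' ∧ μ = μ' :=
  ⟨h.2.1.symm.trans h'.2.1, h.1.symm.trans h'.1⟩

/-- «In each channel we select a distinguished channel edge, and call it an *averaging edge*» (p. 323): a choice of ONE edge in
every channel `m → m + e_μ`. [cite: Federbush1988PhaseCellIV, §1 p. 323] -/
structure AveragingChoice (d M : ℕ) where
  /-- the averaging edge of the channel `m → m + e_μ` -/
  av : (Fin d → ℤ) → Fin d → LEdge d
  /-- it lies in that channel -/
  av_mem : ∀ m μ, av m μ ∈ channel M m μ

namespace AveragingChoice

variable {M : ℕ} (A : AveragingChoice d M)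

/-- `ℰ_A`, «the union of these». [cite: Federbush1988PhaseCellIV, §1 p. 323] -/
def EA : Set (LEdge d) := {e | ∃ m μ, e = A.av m μ}

/-- Averaging edges are channel edges (`ℰ_A ⊆ ℰ_C`). [cite: Federbush1988PhaseCellIV, §1 p. 323] -/
theorem EA_subset_channelEdges : A.EA ⊆ channelEdges M := by
  rintro e ⟨m, μ, rfl⟩
  exact isChannelEdge_of_mem_channel (A.av_mem m μ)

/-- EXACTLY ONE averaging edge in each channel. [cite: Federbush1988PhaseCellIV, §1 p. 323] -/
theorem existsUnique_mem_channel (m : Fin d → ℤ) (μ : Fin d) : ∃! e, e ∈ channel M m μ ∧ e ∈ A.EA := by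
  refine ⟨A.av m μ, ⟨A.av_mem m μ, m, μ, rfl⟩, ?_⟩
  rintro e ⟨he, m', μ', rfl⟩
  obtain ⟨rfl, rfl⟩ := channel_disjoint (A.av_mem m' μ') he
  rfl

/-- The `EdgeClasses` of (1.4) determined by a choice of averaging edges and a family of identity edges `ℰ_I ⊆ ℰ_B`.
[cite: Federbush1988PhaseCellIV, (1.4) p. 323] -/
def toEdgeClasses (EI : Set (LEdge d)) (hEI : EI ⊆ blockEdges M) : EdgeClasses d M :=
  ⟨EI, A.EA, hEI, A.EA_subset_channelEdges⟩

/-- The home averaging edge `ē(m)` of a CHANNEL mode with home edge `e`: the averaging edge of «the channel containing `e(m)`».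
[cite: Federbush1988PhaseCellIV, §2 p. 325] -/
def homeAvg (e : LEdge d) : LEdge d := A.av (blockOf M e.src) e.dir

/-- For a channel edge, `ē(m)` lies in the same channel as `e(m)`. [cite: Federbush1988PhaseCellIV, §2 p. 325] -/
theorem homeAvg_mem_channel {e : LEdge d} (he : IsChannelEdge M e) :
    A.homeAvg e ∈ channel M (blockOf M e.src) e.dir ∧ e ∈ channel M (blockOf M e.src) e.dir :=
  ⟨A.av_mem _ _, mem_channel_of_isChannelEdge he⟩

/-- The two home averaging edges `ē₁(m)`, `ē₂(m)` of a BLOCK mode with home edge `e` in direction `μ` in the block `m`: the averaging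
edges of the two channels «parallel to `e(m)` as indicated», `m − e_μ → m` and `m → m + e_μ`.
[cite: Federbush1988PhaseCellIV, §2 p. 326] -/
def homeAvg₁ (e : LEdge d) : LEdge d := A.av (blockOf M e.src - Pi.single e.dir 1) e.dir

/-- `ē₂(m)`, see `homeAvg₁`. [cite: Federbush1988PhaseCellIV, §2 p. 326] -/
def homeAvg₂ (e : LEdge d) : LEdge d := A.av (blockOf M e.src) e.dir

end AveragingChoice

section Assignments

variable {M : ℕ} (A : AveragingChoice d M) {𝔤 : Type*} [AddCommGroup 𝔤]

/-- **§2, channel mode, (2.1)–(2.3)**: the level-`r` Lie-algebra assignment `e ↦ A(m, e)` of the channel mode with home edge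
`e(m) = e` and amplitude `a = A(m, e(m))`: `a` on `e(m)`, `−a` on `ē(m)` (2.3), `0` on every other edge of `ℰ^r` («If `e` is in
`ℰ^r`, but `e ≠ e(m)`, `e ≠ ē(m)`, then `A(m, e) = 0`»); on coarser levels the assignment is `0` (not part of this level-`r`
function). [cite: Federbush1988PhaseCellIV, (2.1)–(2.3) p. 325] -/
def channelModeA (e : LEdge d) (a : 𝔤) (e' : LEdge d) : 𝔤 :=
  if e' = e then a else if e' = A.homeAvg e then -a else 0

/-- (2.3): «`A(m, e(m)) = −A(m, ē(m))`» (the home edge is a channel MODE edge, so `e(m) ≠ ē(m)`).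
[cite: Federbush1988PhaseCellIV, (2.3) p. 325] -/
theorem channelModeA_homeAvg {e : LEdge d} (hne : A.homeAvg e ≠ e) (a : 𝔤) :
    channelModeA A e a e = -channelModeA A e a (A.homeAvg e) := by
  simp [channelModeA, hne]

/-- «If `e` is in `ℰ^r`, but `e ≠ e(m)`, `e ≠ ē(m)`, then `A(m, e) = 0`.» [cite: Federbush1988PhaseCellIV, §2 p. 325] -/
theorem channelModeA_eq_zero {e e' : LEdge d} (h₁ : e' ≠ e) (h₂ : e' ≠ A.homeAvg e) (a : 𝔤) :
    channelModeA A e a e' = 0 := by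
  simp [channelModeA, h₁, h₂]

/-- **(2.1)/(2.2)**: with `g(m, e) = e^{A(m,e)}` for any «exponential» `expG : 𝔤 → G` with `expG(−a) = expG(a)⁻¹`, (2.3) gives
«`g(m, e(m)) = g⁻¹(m, ē(m))`» (2.2). [cite: Federbush1988PhaseCellIV, (2.1)–(2.2) p. 325] -/
theorem channelMode_g_home {G : Type*} [Group G] (expG : 𝔤 → G) (hexp : ∀ a, expG (-a) = (expG a)⁻¹) {e : LEdge d}
    (hne : A.homeAvg e ≠ e) (a : 𝔤) :
    expG (channelModeA A e a e) = (expG (channelModeA A e a (A.homeAvg e)))⁻¹ := by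
  rw [channelModeA_homeAvg A hne, hexp]

/-- **§3, the `A`-mode**: «consistent with assignments on level `r` of `A(m, e(m))` to `e(m)` and of zero to other edges in
`ℰ^r`» (home edge `e(m) ∈ ℰ_A`). [cite: Federbush1988PhaseCellIV, §3 p. 326–327] -/
def aModeA (e : LEdge d) (a : 𝔤) (e' : LEdge d) : 𝔤 := if e' = e then a else 0

variable [Module ℝ 𝔤]

/-- **§2, block mode, (2.4)**: the level-`r` assignment of the block mode with home edge `e(m) = e ∈ ℰ_BM`, amplitude `a` and
position factors `k₁, k₂`: `a` on `e(m)`, `−k₁a` on `ē₁(m)`, `−k₂a` on `ē₂(m)`, `0` elsewhere on `ℰ^r`.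
[cite: Federbush1988PhaseCellIV, (2.4) p. 326] -/
def blockModeA (k₁ k₂ : ℝ) (e : LEdge d) (a : 𝔤) (e' : LEdge d) : 𝔤 :=
  if e' = e then a else if e' = A.homeAvg₁ e then -(k₁ • a) else if e' = A.homeAvg₂ e then -(k₂ • a) else 0

/-- (2.4), first line: «`A(m, ē₁(m)) = −k₁A(m, e(m))`» (for a block edge `e(m)`, which is not the channel edge `ē₁`).
[cite: Federbush1988PhaseCellIV, (2.4) p. 326] -/
theorem blockModeA_homeAvg₁ (k₁ k₂ : ℝ) {e : LEdge d} (h₁ : A.homeAvg₁ e ≠ e) (a : 𝔤) :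
    blockModeA A k₁ k₂ e a (A.homeAvg₁ e) = -(k₁ • blockModeA A k₁ k₂ e a e) := by
  simp [blockModeA, h₁]

/-- (2.4), second line: «`A(m, ē₂(m)) = −k₂A(m, e(m))`» (`ē₂ ≠ e(m)`, `ē₂ ≠ ē₁` — different channels).
[cite: Federbush1988PhaseCellIV, (2.4) p. 326] -/
theorem blockModeA_homeAvg₂ (k₁ k₂ : ℝ) {e : LEdge d} (h₂ : A.homeAvg₂ e ≠ e) (h₁₂ : A.homeAvg₂ e ≠ A.homeAvg₁ e) (a : 𝔤) :
    blockModeA A k₁ k₂ e a (A.homeAvg₂ e) = -(k₂ • blockModeA A k₁ k₂ e a e) := by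
  simp [blockModeA, h₂, h₁₂]

/-- «*Note.* For our modes in this section all the `A`'s are proportional to the same Lie algebra element» — for channel modes …
[cite: Federbush1988PhaseCellIV, §2 Note p. 326] -/
theorem channelModeA_smul (e : LEdge d) (a : 𝔤) (e' : LEdge d) : ∃ c : ℝ, channelModeA A e a e' = c • a := by
  unfold channelModeA
  split_ifs
  · exact ⟨1, by simp⟩
  · exact ⟨-1, by simp⟩
  · exact ⟨0, by simp⟩

/-- … for block modes … [cite: Federbush1988PhaseCellIV, §2 Note p. 326] -/
theorem blockModeA_smul (k₁ k₂ : ℝ) (e : LEdge d) (a : 𝔤) (e' : LEdge d) :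
    ∃ c : ℝ, blockModeA A k₁ k₂ e a e' = c • a := by
  unfold blockModeA
  split_ifs
  · exact ⟨1, by simp⟩
  · exact ⟨-k₁, by simp [neg_smul]⟩
  · exact ⟨-k₂, by simp [neg_smul]⟩
  · exact ⟨0, by simp⟩

/-- … and for `A`-modes («As with `p`-modes all assignments … are multiples of a single Lie Algebra element», p. 327).
[cite: Federbush1988PhaseCellIV, §3 p. 327] -/
theorem aModeA_smul (e : LEdge d) (a : 𝔤) (e' : LEdge d) : ∃ c : ℝ, aModeA e a e' = c • a := by
  unfold aModeA
  split_ifs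
  · exact ⟨1, by simp⟩
  · exact ⟨0, by simp⟩

end Assignments

end PhaseCellIVLattice

namespace PhaseCellIVChunks

open PhaseCellIVLattice

/-! ## 2. §8: overlap, hunks, chunk partitions, Well-Separation, (8.1) effective level -/

section Hunks

variable {Edge P : Type*}

/-- «We say `𝓜(p₁)` and `𝓜(p₂)` "overlap" if they share an edge.» [cite: Federbush1988PhaseCellIV, §8 p. 332] -/
def Overlap (M₁ M₂ : Set Edge) : Prop := (M₁ ∩ M₂).Nonempty

/-- «This provides an idea of connectivity on the `{𝓜(p)}` … The *hunks* are the connected components of this set»: two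
`L`-plaquettes lie in the same hunk iff they are joined by a chain of overlaps (the equivalence relation generated by
overlapping). [cite: Federbush1988PhaseCellIV, §8 p. 332] -/
def SameHunk (Mf : P → Set Edge) : P → P → Prop := Relation.EqvGen fun p q => Overlap (Mf p) (Mf q)

/-- `SameHunk` is an equivalence relation. [cite: Federbush1988PhaseCellIV, §8 p. 332] -/
theorem sameHunk_equivalence (Mf : P → Set Edge) : Equivalence (SameHunk Mf) :=
  Relation.EqvGen.is_equivalence _

/-- «Thus each hunk is some union of elements `𝓜(p_i)`»: the edge set of the hunk of `p`. [cite: Federbush1988PhaseCellIV, §8 p. 332] -/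
def hunkEdges (Mf : P → Set Edge) (p : P) : Set Edge := ⋃ q ∈ {q | SameHunk Mf p q}, Mf q

/-- `𝓜(p)` lies in the hunk of `p`. [cite: Federbush1988PhaseCellIV, §8 p. 332] -/
theorem subset_hunkEdges (Mf : P → Set Edge) (p : P) : Mf p ⊆ hunkEdges Mf p :=
  subset_biUnion_of_mem (show p ∈ {q | SameHunk Mf p q} from Relation.EqvGen.refl p)

/-- Overlapping `𝓜(p)`, `𝓜(q)` have the same hunk. [cite: Federbush1988PhaseCellIV, §8 p. 332] -/
theorem hunkEdges_eq_of_overlap (Mf : P → Set Edge) {p q : P} (h : Overlap (Mf p) (Mf q)) : hunkEdges Mf p = hunkEdges Mf q := by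
  have hpq : SameHunk Mf p q := Relation.EqvGen.rel p q h
  ext e
  simp only [hunkEdges, mem_iUnion, mem_setOf_eq, exists_prop]
  constructor
  · rintro ⟨q', hq', he⟩
    exact ⟨q', (sameHunk_equivalence Mf).trans ((sameHunk_equivalence Mf).symm hpq) hq', he⟩
  · rintro ⟨q', hq', he⟩
    exact ⟨q', (sameHunk_equivalence Mf).trans hpq hq', he⟩

/-- The metric data §8 uses («in distance, as above … all objects are viewed living in `R⁴`»): edge lengths, the distance from
an edge to an edge set, diameters of edge sets — PARAMETERS here. [cite: Federbush1988PhaseCellIV, §8 Note p. 332] -/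
structure EdgeGeometry (Edge : Type*) where
  /-- the length of an edge (`N^{−s}` for `e ∈ ℰ^s`) -/
  len : Edge → ℝ
  /-- the distance in `R⁴` from an edge to a set of edges -/
  distTo : Edge → Set Edge → ℝ
  /-- the diameter `d(E)` in `R⁴` of a set of edges -/
  diam : Set Edge → ℝ

/-- «We let `ℰ_u(E)`, the *umbrella edges* of `E`, be the union of edges of length `≤ C_2c d(E)`, and at distance `≤ C_2c d(E)`
from `E`.» [cite: Federbush1988PhaseCellIV, §8 p. 332] -/
def umbrella (geo : EdgeGeometry Edge) (C2c : ℝ) (E : Set Edge) : Set Edge :=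
  {e | geo.len e ≤ C2c * geo.diam E ∧ geo.distTo e E ≤ C2c * geo.diam E}

/-- **Well-Separation of Chunks** p. 332: «if `E′` is any chunk with `d(E′) ≥ d(E)`, the edges of `E′` do not intersect the edges
in `ℰ_u(E)`» — for a family of chunks (edge sets) indexed by `ι`, and `E′ ≠ E`. [cite: Federbush1988PhaseCellIV, §8 p. 332] -/
def WellSeparated {ι : Type*} (geo : EdgeGeometry Edge) (C2c : ℝ) (chunk : ι → Set Edge) : Prop :=
  ∀ i j, i ≠ j → geo.diam (chunk i) ≤ geo.diam (chunk j) → Disjoint (chunk j) (umbrella geo C2c (chunk i))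

/-- «Each chunk will be a union of hunks, the chunks will be disjoint, and their union will be the union of hunks.  Thus
specifying the chunks is equivalent to determining a partition of the set of hunks»: a chunk system = a labelling of the
`L`-plaquettes by chunks, constant on hunks; the chunk `i` is the union of the `𝓜(p)` with label `i`.
[cite: Federbush1988PhaseCellIV, §8 p. 332] -/
structure ChunkSystem (Edge P ι : Type*) (Mf : P → Set Edge) where
  /-- the chunk containing (the hunk of) `p` -/
  label : P → ι
  /-- chunks are unions of hunks -/
  label_hunk : ∀ p q, SameHunk Mf p q → label p = label q

/-- The edge set of the chunk `i`. [cite: Federbush1988PhaseCellIV, §8 p. 332] -/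
def ChunkSystem.chunk {ι : Type*} {Mf : P → Set Edge} (S : ChunkSystem Edge P ι Mf) (i : ι) : Set Edge :=
  ⋃ p ∈ {p | S.label p = i}, Mf p

/-- Every hunk lies inside one chunk. [cite: Federbush1988PhaseCellIV, §8 p. 332] -/
theorem ChunkSystem.hunkEdges_subset_chunk {ι : Type*} {Mf : P → Set Edge} (S : ChunkSystem Edge P ι Mf) (p : P) :
    hunkEdges Mf p ⊆ S.chunk (S.label p) := by
  intro e he
  simp only [hunkEdges, ChunkSystem.chunk, mem_iUnion, mem_setOf_eq, exists_prop] at he ⊢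
  obtain ⟨q, hq, he⟩ := he
  exact ⟨q, (S.label_hunk p q hq).symm, he⟩

/-- A chunk system `S′` REFINES `S` if every chunk of `S′` lies in a chunk of `S` («finest partition»).
[cite: Federbush1988PhaseCellIV, §8 p. 332] -/
def ChunkSystem.Refines {ι ι' : Type*} {Mf : P → Set Edge} (S' : ChunkSystem Edge P ι' Mf) (S : ChunkSystem Edge P ι Mf) :
    Prop :=
  ∀ p q, S'.label p = S'.label q → S.label p = S.label q

/-- «This partition is selected as a finest partition (not necessarily unique?) for which the following property holds»: `S` is
well separated and every well-separated refinement of `S` induces the same partition. [cite: Federbush1988PhaseCellIV, §8 p. 332] -/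
def IsFinestWellSeparated {ι : Type*} {Mf : P → Set Edge} (geo : EdgeGeometry Edge) (C2c : ℝ)
    (S : ChunkSystem Edge P ι Mf) : Prop :=
  WellSeparated geo C2c S.chunk ∧
    ∀ (ι' : Type) (S' : ChunkSystem Edge P ι' Mf), S'.Refines S → WellSeparated geo C2c S'.chunk → S.Refines S'

end Hunks

section EffLevel

open Classical in
/-- **(8.1)** p. 332: «The effective level `r_e(E)` of a chunk is the largest `r′` such that `N^{−r′} ≥ d(E)` (8.1) … [We do not let
`r_e(E)` be negative, if (8.1) selects a negative number we set `r_e = 0`.]» — for a diameter `δ` and the block parameter `N`: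
the least `r` with `N^{−(r+1)} < δ` when `0 < δ ≤ 1` and `N ≥ 2` (equivalently the largest `r′` with `N^{−r′} ≥ δ`), and `0`
otherwise. [cite: Federbush1988PhaseCellIV, (8.1) p. 332] -/
def effLevel (N : ℕ) (δ : ℝ) : ℕ :=
  if h : ∃ r : ℕ, edgeLen N (r + 1) < δ then Nat.find h else 0

/-- For `N ≥ 2` and `δ > 0` some level is finer than `δ`. [cite: Federbush1988PhaseCellIV, (8.1) p. 332] -/
theorem exists_edgeLen_lt {N : ℕ} (hN : 2 ≤ N) {δ : ℝ} (hδ : 0 < δ) : ∃ r : ℕ, edgeLen N (r + 1) < δ := by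
  have h1 : ((N : ℝ))⁻¹ < 1 := by
    rw [inv_lt_one_iff₀]; right; exact_mod_cast hN
  have h0 : 0 ≤ ((N : ℝ))⁻¹ := by positivity
  obtain ⟨n, hn⟩ := exists_pow_lt_of_lt_one hδ h1
  refine ⟨n, lt_of_le_of_lt ?_ hn⟩
  rw [edgeLen, ← inv_pow]
  exact pow_le_pow_of_le_one h0 h1.le (Nat.le_succ n)

/-- (8.1), lower side: `δ > N^{−(r_e+1)}` — `r_e` is the LARGEST level with `N^{−r′} ≥ δ`. [cite: Federbush1988PhaseCellIV,
(8.1) p. 332] -/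
theorem edgeLen_effLevel_succ_lt {N : ℕ} (hN : 2 ≤ N) {δ : ℝ} (hδ : 0 < δ) : edgeLen N (effLevel N δ + 1) < δ := by
  have h := exists_edgeLen_lt hN hδ
  rw [effLevel, dif_pos h]
  exact Nat.find_spec h

/-- (8.1), upper side: `N^{−r_e} ≥ δ` whenever `δ ≤ 1` (for `δ > 1` print sets `r_e = 0`). [cite: Federbush1988PhaseCellIV,
(8.1) p. 332] -/
theorem le_edgeLen_effLevel {N : ℕ} (hN : 2 ≤ N) {δ : ℝ} (hδ : 0 < δ) (hδ1 : δ ≤ 1) : δ ≤ edgeLen N (effLevel N δ) := by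
  have h := exists_edgeLen_lt hN hδ
  rw [effLevel, dif_pos h]
  rcases Nat.eq_zero_or_pos (Nat.find h) with h0 | hpos
  · rw [h0, edgeLen_zero]; exact hδ1
  · obtain ⟨k, hk⟩ := Nat.exists_eq_add_of_lt hpos
    rw [zero_add] at hk
    have hmin := Nat.find_min h (show k < Nat.find h by omega)
    rw [hk]
    exact not_lt.mp hmin

/-- For `δ > 1` (8.1) would select a negative level; print sets `r_e = 0`, and so does `effLevel`.
[cite: Federbush1988PhaseCellIV, (8.1) p. 332] -/
theorem effLevel_eq_zero_of_one_lt {N : ℕ} (hN : 2 ≤ N) {δ : ℝ} (hδ1 : 1 < δ) : effLevel N δ = 0 := by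
  have hδ : 0 < δ := lt_trans one_pos hδ1
  have h := exists_edgeLen_lt hN hδ
  rw [effLevel, dif_pos h, Nat.find_eq_zero]
  have hN' : (1 : ℝ) ≤ N := by exact_mod_cast (le_trans (by norm_num) hN)
  calc edgeLen N (0 + 1) = ((N : ℝ))⁻¹ := by simp [edgeLen]
    _ ≤ 1 := inv_le_one_of_one_le₀ hN'
    _ < δ := hδ1

/-- «`v(E)`, the pinning vertex, is in `𝒱^{r_e}`, and chosen at distance `< N^{−r_e}` from `E`» — the requirement on a pinning
vertex, for a chunk with diameter `δ` and distance-to-`E` function `dE` on `R⁴`. [cite: Federbush1988PhaseCellIV, §8 p. 332] -/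
def IsPinningVertex {d : ℕ} (N : ℕ) (δ : ℝ) (dE : EuclideanSpace ℝ (Fin d) → ℝ) (v : EuclideanSpace ℝ (Fin d)) : Prop :=
  v ∈ vertices d N (effLevel N δ) ∧ dE v < edgeLen N (effLevel N δ)

end EffLevel

/-! ## 3. §9: the identity rules (9.1), (9.3)–(9.6), the increments (9.2), the Global Gauge Requirement -/

section ChunkField

variable {Edge G : Type*} [Group G]

/-- **(9.2)** p. 333: «We introduce `g^δ(·, ·)` such that `g(e, r) = g^δ(e, r) g(e, r − 1)`» — the increment of the sequence of
approximate assignments `g(e, r)`. [cite: Federbush1988PhaseCellIV, (9.2) p. 333] -/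
def gDelta (gseq : Edge → ℕ → G) (e : Edge) (r : ℕ) : G := gseq e r * (gseq e (r - 1))⁻¹

/-- (9.2) as printed. [cite: Federbush1988PhaseCellIV, (9.2) p. 333] -/
theorem gDelta_mul (gseq : Edge → ℕ → G) (e : Edge) (r : ℕ) : gDelta gseq e r * gseq e (r - 1) = gseq e r := by
  simp [gDelta]

/-- The identity rules of the isolated chunk field, p. 333: (9.1) «`g(e) = g(e, r(e))` if `e ∈ ℰ_I`», (9.3) «`g(e) = Id` if
`r(e) < r(E)`», (9.4) «`g(e) = Id` if `e ∈ ℰ_I^{r(E)}`», (9.5) «`g(e) = Id` if `r(e) = r(E)`, `e ∉ E`, `e ∉ ℰ_A`», (9.6) «`g(e, r) = Id`,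
for `r ≤ r(E)`» — for the final assignment `g`, the approximations `gseq`, the level function `lvl = r(·)`, the chunk level
`rE = r(E)`, the chunk's edge set `E` and the classes `ℰ_I`, `ℰ_A`. [cite: Federbush1988PhaseCellIV, (9.1), (9.3)–(9.6) p. 333] -/
structure ChunkFieldRules (g : Edge → G) (gseq : Edge → ℕ → G) (lvl : Edge → ℕ) (rE : ℕ) (E EI EA : Set Edge) : Prop where
  /-- (9.1) -/
  eq91 : ∀ e ∈ EI, g e = gseq e (lvl e)
  /-- (9.3) -/
  eq93 : ∀ e, lvl e < rE → g e = 1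
  /-- (9.4) -/
  eq94 : ∀ e ∈ EI, lvl e = rE → g e = 1
  /-- (9.5) -/
  eq95 : ∀ e, lvl e = rE → e ∉ E → e ∉ EA → g e = 1
  /-- (9.6) -/
  eq96 : ∀ e r, r ≤ rE → gseq e r = 1

/-- Under (9.6) the increments (9.2) are trivial up to the chunk level: `g^δ(e, r) = Id` for `r ≤ r(E)`.
[cite: Federbush1988PhaseCellIV, (9.2), (9.6) p. 333] -/
theorem gDelta_eq_one_of_le {g : Edge → G} {gseq : Edge → ℕ → G} {lvl : Edge → ℕ} {rE : ℕ} {E EI EA : Set Edge}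
    (h : ChunkFieldRules g gseq lvl rE E EI EA) (e : Edge) {r : ℕ} (hr : r ≤ rE) : gDelta gseq e r = 1 := by
  rw [gDelta, h.eq96 e r hr, h.eq96 e (r - 1) (le_trans (Nat.sub_le r 1) hr)]
  simp

/-- **Global Gauge Requirement** p. 333: «If the internal variables of a chunk are modified by sending `g → hgh⁻¹`, for some fixed
`h`, then the isolated field assignment to any edge `e` likewise is changed `g(e) → hg(e)h⁻¹`» — for the assignment `field` as a
function of the (ordered) internal variables `ι → G`. [cite: Federbush1988PhaseCellIV, §9 p. 333] -/
def GlobalGaugeReq {ι : Type*} (field : (ι → G) → Edge → G) : Prop :=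
  ∀ (h : G) (gs : ι → G) (e : Edge), field (fun i => h * gs i * h⁻¹) e = h * field gs e * h⁻¹

/-- «We may determine the isolated chunk field for one point in each orbit of this action, and use the Global Gauge Requirement
to determine the isolated chunk field for any set of variables»: an assignment DEFINED by conjugating a representative's field
satisfies the requirement, provided the representative data are chosen equivariantly.  Simplest instance: a field built from
products of the internal variables, e.g. `e ↦ gs i · gs j`, satisfies it. [cite: Federbush1988PhaseCellIV, §9 p. 333] -/
theorem globalGaugeReq_mul {ι : Type*} (i j : Edge → ι) : GlobalGaugeReq (fun (gs : ι → G) (e : Edge) => gs (i e) * gs (j e)) := by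
  intro h gs e
  simp [mul_assoc]

end ChunkField

/-! ## 4. §10: the local partition of unity (10.1), the averages (10.2)–(10.3), the cut-off field (10.7), the re-gauging (10.9) -/

section FieldInterpolation

variable {d : ℕ} {V G : Type*}

/-- **(10.1)** p. 334: «a `C^∞` partition of unity associated to these vertices, `{φ′_v(x)}`, such that `φ′_v(x) = 0` for
`d(x, v) > 4N^{−r}`. (10.1)  We require `Σ_{v∈𝒱_c^r} φ′_v(x) = 1` outside `E ∩ ℒ^r`» — for a family indexed by the vertices
outside `E` (positions `vpos`), the solid chunk region `Esolid ⊆ R⁴`. [cite: Federbush1988PhaseCellIV, (10.1) p. 334] -/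
structure IsLocalPOU (N r : ℕ) (vpos : V → EuclideanSpace ℝ (Fin d)) (Esolid : Set (EuclideanSpace ℝ (Fin d)))
    (φ : V → EuclideanSpace ℝ (Fin d) → ℝ) : Prop where
  /-- smoothness -/
  smooth : ∀ v, ContDiff ℝ (⊤ : ℕ∞) (φ v)
  /-- (10.1) support -/
  support : ∀ v x, 4 * edgeLen N r < dist x (vpos v) → φ v x = 0
  /-- the partition-of-unity identity outside `E` -/
  sum_one : ∀ x ∉ Esolid, HasSum (fun v => φ v x) 1

/-- **(10.2)–(10.3)** p. 334: «`g(e′) = Av_v g^v(e′)`, (10.2) defined by minimizing `Σ_v φ′_v(ê′) d²(g(e′), g^v(e′))` (10.3)» — `x`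
minimises the weighted squared distances to the candidates `g^v(e′)` (weights `φ′_v(ê′)`, finitely many non-zero).
[cite: Federbush1988PhaseCellIV, (10.2)–(10.3) p. 334] -/
def IsFieldAverage [PseudoMetricSpace G] (vs : Finset V) (w : V → ℝ) (gv : V → G) (x : G) : Prop :=
  IsMinOn (fun y : G => ∑ v ∈ vs, w v * dist y (gv v) ^ 2) univ x

/-- With a single vertex of weight one the average is that candidate. [cite: Federbush1988PhaseCellIV, (10.2)–(10.3) p. 334] -/
theorem isFieldAverage_singleton [PseudoMetricSpace G] (gv : V → G) (v : V) : IsFieldAverage {v} (fun _ => 1) gv (gv v) := by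
  intro y _
  simp [dist_self]

/-- **(10.7)** p. 335: «`A(e) = A^α(e)` if `d(e, v) < (C_1c/2)·N^{−r}`; `= A₀^α(e)` if `d(e, v) ≥ (C_1c/2)·N^{−r}`» — the field cut
off to its constant-curvature part `A₀` away from `v` (distances `dv`, constant `C_1c` parameters). [cite: Federbush1988PhaseCellIV,
(10.6)–(10.7) p. 334–335] -/
def cutoffField {Edge 𝔤 : Type*} (N r : ℕ) (C1c : ℝ) (dv : Edge → ℝ) (A A₀ : Edge → 𝔤) (e : Edge) : 𝔤 :=
  if dv e < C1c / 2 * edgeLen N r then A e else A₀ e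

/-- (10.7) near `v`: the full field. [cite: Federbush1988PhaseCellIV, (10.7) p. 335] -/
theorem cutoffField_near {Edge 𝔤 : Type*} {N r : ℕ} {C1c : ℝ} {dv : Edge → ℝ} (A A₀ : Edge → 𝔤) {e : Edge}
    (h : dv e < C1c / 2 * edgeLen N r) : cutoffField N r C1c dv A A₀ e = A e := by
  simp [cutoffField, h]

/-- (10.7) far from `v`: the constant-curvature part. [cite: Federbush1988PhaseCellIV, (10.7) p. 335] -/
theorem cutoffField_far {Edge 𝔤 : Type*} {N r : ℕ} {C1c : ℝ} {dv : Edge → ℝ} (A A₀ : Edge → 𝔤) {e : Edge}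
    (h : C1c / 2 * edgeLen N r ≤ dv e) : cutoffField N r C1c dv A A₀ e = A₀ e := by
  simp [cutoffField, not_lt.mpr h]

/-- **(10.9)** p. 335: «`g^v(e′) = ψ⁻¹(v_a) h̃_v(e′) ψ(v_b)`» — re-gauging the abelian-gauge field `h̃_v` by vertex elements `ψ`.
[cite: Federbush1988PhaseCellIV, (10.9) p. 335] -/
def regauge [Group G] (ψ : V → G) (h : V → V → G) (a b : V) : G := (ψ a)⁻¹ * h a b * ψ b

/-- (10.9) preserves plaquette products up to conjugation (it is a gauge transformation): for a closed loop `v₁v₂v₃v₄v₁`.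
[cite: Federbush1988PhaseCellIV, (10.9) p. 335] -/
theorem regauge_plaquette [Group G] (ψ : V → G) (h : V → V → G) (v₁ v₂ v₃ v₄ : V) :
    regauge ψ h v₁ v₂ * regauge ψ h v₂ v₃ * regauge ψ h v₃ v₄ * regauge ψ h v₄ v₁ =
      (ψ v₁)⁻¹ * (h v₁ v₂ * h v₂ v₃ * h v₃ v₄ * h v₄ v₁) * ψ v₁ := by
  simp only [regauge, mul_assoc, mul_inv_cancel_left]

end FieldInterpolation

end PhaseCellIVChunks

end

end Literature.MathematicalPhysics.QuantumFieldTheory.Federbush1986
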